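import Summits.QuantumFields.BalabanUV.Beta.GAN24.BornLambdaLineage

/-!
# `BalabanUV.Beta.GAN24.BornLambdaLetters` — binder row G-an2-4 / (CONV-C), CT-ROUTE, BORNSEC (V8) Λ half (banner leaf-01, OWNER (W1) l.33005), PART 3:
# **THE Λ-BORN ROW FROM PER-LINEAGE GEOMETRIC LETTERS** — the two letters `hU`, `hC` of PART 1's socket `exists_hBLam_of_letters(_three)` are sums over the birth levels
# `i < k`; if each summand is a local stencil family with constant `C·θ^{k−i}`, `0 ≤ θ < 1` (road S3's row shape: `TaylorRowLam.rowL_three` gives `cL·(Lc⁻¹)^{n−m}` for the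
# undressed one-shot family), the sums are local stencil families with the `k`-FREE constant `C·θ∕(1−θ)` — so the Λ-born row `hB(0, cΛ)` follows from two PER-LINEAGE letters

NOT IN PRINT; OUR BOOKKEEPING (G-an2-4 formalisation swarm → CRUX TEAM (2), leaf prover `b2b-balaban-gan24-formalise-leaf-01`, gen 59).  [folklore] geometric-series bookkeeping
over an2's `OneStepResolventKernel.biLoc_finset_sum` and PART 1 BY NAME; 0 `def`, 0 cited facts, 0 `def … : Prop`, 0 sorry.  Method-agnostic: per the OWNER's RULING
R-gan24p1-g20-1 the per-lineage letters will NOT come from the envelope cell bounds; BORNSEC-PLAN v1 (after ENGINE-B20; «HESSIAN TRANSFER» + «E2-TENT») is to supply them —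
THIS FILE fixes the shape they must have and does the summation once.  HONEST FRAMING (cell contract, verbatim): «discharging `BetaPertH` makes Bałaban's UV stability
UNCONDITIONAL — a real constructive-QFT result; it is NOT the continuum limit and NOT the Clay problem.»  HONEST DEPENDENCY (verbatim): «continuum YM on T⁴ ⇐ BetaPertH ∧
nine spine estimates (0/9 proved); BetaPertH ⇐ (D1) ∧ (D4) ∧ CAP+tail; G-an2-4 gates asym, D1 and NE2/3/4.»

## What (generic `d` unless marked)
* §1 `locStencil_finset_sum` (constants add at a common rate), `sum_pow_sub_le` (`Σ_{i<k} θ^{k−i} ≤ θ∕(1−θ)` for `0 ≤ θ < 1`), **`locStencil_sum_of_geometric`**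
  (summands with constants `C·θ^{k−i}` ⇒ the sum with the `k`-free constant `C·(θ∕(1−θ))`).
* §2 **`exists_hU_of_geometric`** ∕ **`exists_hC_of_geometric`** — PART 1's letters `hU`, `hC` from PER-LINEAGE geometric letters (any family of summands; stated for the
  exact summands of `BornLambdaLineage.exists_hBLam_of_letters`).
* §3 **`exists_hBLam_of_geometric`** (generic `d`, with `hX`) and **`exists_hBLam_of_geometric_three`** (`d = 3`, `hX` discharged by PART 1): the Λ-born row from the two
  per-lineage geometric letters — the END SHAPE BORNSEC v1's Λ half has to deliver, lineage by lineage.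
Discharges NO slot letter; NO estimate; 0 wall binders; NEVER «G-an2-4 closed»; NOT D1, NOT BetaPertH, NOT continuum, NOT Clay.
-/

noncomputable section

open Finset
open scoped BigOperators
open Literature.MathematicalPhysics.QuantumFieldTheory
open Literature.MathematicalPhysics.QuantumFieldTheory.Balaban1983to89
open Literature.MathematicalPhysics.QuantumFieldTheory.Balaban1983to89.Beta
open ExpKernelCalculus (MKer)
open AffineAveraging (box toSite)
open OneStepResolventKernel (Fib LocStencil biLoc_finset_sum)
open BalabanStepJets (locStencil_mono)
open BalabanCompositeJets (respStep)
open Summit.QuantumFields.BalabanUV.Beta.HessKerDressedUnits (unitS)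
open Summit.QuantumFields.BalabanUV.Beta.GAN24.CombesThomas (sfStep smStep)
open Summit.QuantumFields.BalabanUV.Beta.GAN24.StencilSlotOfShapes (locStencil_mono')
open Summit.QuantumFields.BalabanUV.Beta.GAN24.Push4Iter (legChain)
open Summit.QuantumFields.BalabanUV.Beta.GAN24.Push3 (push₃)
open Summit.QuantumFields.BalabanUV.Beta.GAN24.RespStepBmDecompExact (respStepBmSeq)
open Summit.QuantumFields.BalabanUV.Beta.GAN24.SrecWilsonSector (bornSecAt)
open Summit.QuantumFields.BalabanUV.Beta.GAN24.SrecBornSector (freshAt)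
open Summit.QuantumFields.BalabanUV.Beta.GAN24.BornLambdaLineage (exists_hBLam_of_letters exists_hX_lam_three)

namespace Summit.QuantumFields.BalabanUV.Beta.GAN24.BornLambdaLetters

variable {d : ℕ}

/-! ## §1 Finite sums of local stencil families; the geometric series -/

/-- [folklore] **A FINITE SUM OF LOCAL STENCIL FAMILIES AT A COMMON RATE IS A LOCAL STENCIL FAMILY, CONSTANTS ADDED** (an2's `biLoc_finset_sum` root by root). -/
theorem locStencil_finset_sum {ι : Type*} (s : Finset ι) {F : ι → Fin (d + 1) → (Fin (d + 1) → ℤ) → MKer (d + 1) (Fib d)} {C : ι → ℝ} {δ : ℝ}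
    (h : ∀ i ∈ s, LocStencil (F i) (C i) δ) : LocStencil (∑ i ∈ s, F i) (∑ i ∈ s, C i) δ := by
  intro κ u
  have e : (∑ i ∈ s, F i) κ u = fun x z a b => ∑ i ∈ s, F i κ u x z a b := by
    funext x z a b
    simp only [Finset.sum_apply]
  rw [e]
  exact biLoc_finset_sum s fun i hi => h i hi κ u

/-- [folklore] THE GEOMETRIC SERIES OVER THE BIRTH LEVELS: `Σ_{i<k} θ^{k−i} ≤ θ∕(1−θ)` for `0 ≤ θ < 1` (uniformly in `k`). -/
theorem sum_pow_sub_le {θ : ℝ} (hθ0 : 0 ≤ θ) (hθ1 : θ < 1) (k : ℕ) : ∑ i ∈ Finset.range k, θ ^ (k - i) ≤ θ / (1 - θ) := by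
  have h1 : 0 < 1 - θ := by linarith
  -- re-index `i ↦ k − 1 − i`: the exponents `k − i`, `i < k`, are `m + 1`, `m < k`
  have e : ∑ i ∈ Finset.range k, θ ^ (k - i) = ∑ m ∈ Finset.range k, θ ^ (m + 1) := by
    rw [← Finset.sum_range_reflect]
    refine Finset.sum_congr rfl fun m hm => ?_
    have hmk := Finset.mem_range.1 hm
    congr 1
    omega
  rw [e]
  have e2 : ∑ m ∈ Finset.range k, θ ^ (m + 1) = θ * ∑ m ∈ Finset.range k, θ ^ m := by
    rw [Finset.mul_sum]
    refine Finset.sum_congr rfl fun m _ => ?_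
    ring
  rw [e2, le_div_iff₀ h1]
  have hg : (∑ m ∈ Finset.range k, θ ^ m) * (1 - θ) = 1 - θ ^ k := by
    have := geom_sum_mul_neg θ k
    linarith [this]
  have hk : 0 ≤ θ ^ k := pow_nonneg hθ0 k
  nlinarith [hg, hk]

/-- NOT IN PRINT; OUR BOOKKEEPING.  **A SUM OVER BIRTH LEVELS WITH GEOMETRIC CONSTANTS IS A LOCAL STENCIL FAMILY WITH A `k`-FREE CONSTANT**: if every summand `i < k` is a local
stencil family with constant `C·θ^{k−i}` at the common rate `δ` (`0 ≤ C`, `0 ≤ θ < 1`), then the sum is one with constant `C·(θ∕(1−θ))`. -/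
theorem locStencil_sum_of_geometric {F : ℕ → Fin (d + 1) → (Fin (d + 1) → ℤ) → MKer (d + 1) (Fib d)} {C θ δ : ℝ} (hC : 0 ≤ C) (hθ0 : 0 ≤ θ) (hθ1 : θ < 1)
    (k : ℕ) (h : ∀ i, i < k → LocStencil (F i) (C * θ ^ (k - i)) δ) :
    LocStencil (∑ i ∈ Finset.range k, F i) (C * (θ / (1 - θ))) δ := by
  have h1 := locStencil_finset_sum (Finset.range k) (C := fun i => C * θ ^ (k - i)) fun i hi => h i (Finset.mem_range.1 hi)
  have hsum : ∑ i ∈ Finset.range k, C * θ ^ (k - i) ≤ C * (θ / (1 - θ)) := by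
    rw [← Finset.mul_sum]
    exact mul_le_mul_of_nonneg_left (sum_pow_sub_le hθ0 hθ1 k) hC
  exact locStencil_mono' h1 hsum le_rfl

/-! ## §2 PART 1's letters `hU`, `hC` from per-lineage geometric letters -/

section Letters

variable {Lc : ℕ} [NeZero Lc]

/-- NOT IN PRINT; OUR BOOKKEEPING.  **THE UNDRESSED-LINEAGE LETTER `hU` FROM A PER-LINEAGE GEOMETRIC LETTER** ((V3)-Λ's expected shape — road S3's row Λ is
`cL·(Lc⁻¹)^{n−m}`): if every weighted undressed Λ lineage `(cE·Lc^{2(d+1)})^{k−i} • push₃ B_i B_i B_i X_i`, `i < k`, is a local stencil family with constant `C·θ^{k−i}` at one rate,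
uniformly in the in-block root, then their sum over `i < k` is one with the `k`-free constant `C·θ∕(1−θ)`. -/
theorem exists_hU_of_geometric (cE cΛ : ℝ)
    (hUg : ∃ C θ δ : ℝ, 0 ≤ C ∧ 0 ≤ θ ∧ θ < 1 ∧ 0 < δ ∧ ∀ (rr : Fin (d + 1) → ℕ), rr ∈ box (d + 1) Lc → ∀ k i : ℕ, i < k →
      LocStencil (fun κ' u' => (cE * (Lc : ℝ) ^ (2 * (d + 1))) ^ (k - i) •
        push₃ (respStep (d := d) (Lc ^ i) (Lc ^ k)) (respStep (d := d) (Lc ^ i) (Lc ^ k)) (respStep (d := d) (Lc ^ i) (Lc ^ k))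
          (unitS (sfStep Lc i) (smStep d Lc i) (freshAt Lc (toSite rr) 0 cΛ i)) κ' u') (C * θ ^ (k - i)) δ) :
    ∃ C δ : ℝ, 0 < δ ∧ ∀ (rr : Fin (d + 1) → ℕ), rr ∈ box (d + 1) Lc → ∀ k : ℕ,
      LocStencil (∑ i ∈ Finset.range k, fun κ' u' => (cE * (Lc : ℝ) ^ (2 * (d + 1))) ^ (k - i) •
        push₃ (respStep (d := d) (Lc ^ i) (Lc ^ k)) (respStep (d := d) (Lc ^ i) (Lc ^ k)) (respStep (d := d) (Lc ^ i) (Lc ^ k))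
          (unitS (sfStep Lc i) (smStep d Lc i) (freshAt Lc (toSite rr) 0 cΛ i)) κ' u') C δ := by
  obtain ⟨C, θ, δ, hC, hθ0, hθ1, hδ, h⟩ := hUg
  exact ⟨C * (θ / (1 - θ)), δ, hδ, fun rr hrr k => locStencil_sum_of_geometric hC hθ0 hθ1 k fun i hi => h rr hrr k i hi⟩

/-- NOT IN PRINT; OUR BOOKKEEPING.  **THE CONTACT LETTER `hC` FROM A PER-LINEAGE GEOMETRIC LETTER** (the shape BORNSEC-PLAN v1's Λ half has to deliver for the two-cell
contact terms of PART 2 `BornLambdaContactCells`): per-lineage constants `C·θ^{k−i}` ⇒ the sum with `C·θ∕(1−θ)`. -/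
theorem exists_hC_of_geometric (cE cΛ : ℝ)
    (hCg : ∃ C θ δ : ℝ, 0 ≤ C ∧ 0 ≤ θ ∧ θ < 1 ∧ 0 < δ ∧ ∀ (rr : Fin (d + 1) → ℕ), rr ∈ box (d + 1) Lc → ∀ k i : ℕ, i < k →
      LocStencil (fun κ' u' => (cE * (Lc : ℝ) ^ (2 * (d + 1))) ^ (k - i) •
        (push₃ (legChain (respStepBmSeq (toSite rr) Lc) i (k - 1 - i)) (legChain (respStepBmSeq (toSite rr) Lc) i (k - 1 - i))
            (legChain (respStepBmSeq (toSite rr) Lc) i (k - 1 - i)) (unitS (sfStep Lc i) (smStep d Lc i) (freshAt Lc (toSite rr) 0 cΛ i)) κ' u'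
          - push₃ (respStep (d := d) (Lc ^ i) (Lc ^ k)) (respStep (d := d) (Lc ^ i) (Lc ^ k)) (respStep (d := d) (Lc ^ i) (Lc ^ k))
            (unitS (sfStep Lc i) (smStep d Lc i) (freshAt Lc (toSite rr) 0 cΛ i)) κ' u')) (C * θ ^ (k - i)) δ) :
    ∃ C δ : ℝ, 0 < δ ∧ ∀ (rr : Fin (d + 1) → ℕ), rr ∈ box (d + 1) Lc → ∀ k : ℕ,
      LocStencil (∑ i ∈ Finset.range k, fun κ' u' => (cE * (Lc : ℝ) ^ (2 * (d + 1))) ^ (k - i) •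
        (push₃ (legChain (respStepBmSeq (toSite rr) Lc) i (k - 1 - i)) (legChain (respStepBmSeq (toSite rr) Lc) i (k - 1 - i))
            (legChain (respStepBmSeq (toSite rr) Lc) i (k - 1 - i)) (unitS (sfStep Lc i) (smStep d Lc i) (freshAt Lc (toSite rr) 0 cΛ i)) κ' u'
          - push₃ (respStep (d := d) (Lc ^ i) (Lc ^ k)) (respStep (d := d) (Lc ^ i) (Lc ^ k)) (respStep (d := d) (Lc ^ i) (Lc ^ k))
            (unitS (sfStep Lc i) (smStep d Lc i) (freshAt Lc (toSite rr) 0 cΛ i)) κ' u')) C δ := by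
  obtain ⟨C, θ, δ, hC, hθ0, hθ1, hδ, h⟩ := hCg
  exact ⟨C * (θ / (1 - θ)), δ, hδ, fun rr hrr k => locStencil_sum_of_geometric hC hθ0 hθ1 k fun i hi => h rr hrr k i hi⟩

/-! ## §3 The Λ-born row from the two per-lineage geometric letters -/

/-- NOT IN PRINT; OUR BOOKKEEPING ((V8) Λ half, END SHAPE; generic `d`).  **THE Λ-BORN ROW FROM PER-LINEAGE GEOMETRIC LETTERS**: the born Λ-pieces' own locality `hX`, a geometric
letter for every weighted UNDRESSED lineage and one for every weighted CONTACT term (constants `C·θ^{k−i}`, `θ < 1`, one rate, uniform in the in-block root) give `hB(0, cΛ)`. -/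
theorem exists_hBLam_of_geometric (cE cΛ : ℝ)
    (hX : ∃ C δ : ℝ, 0 < δ ∧ ∀ (rr : Fin (d + 1) → ℕ), rr ∈ box (d + 1) Lc →
      ∀ k : ℕ, LocStencil (unitS (sfStep Lc k) (smStep d Lc k) (freshAt Lc (toSite rr) 0 cΛ k)) C δ)
    (hUg : ∃ C θ δ : ℝ, 0 ≤ C ∧ 0 ≤ θ ∧ θ < 1 ∧ 0 < δ ∧ ∀ (rr : Fin (d + 1) → ℕ), rr ∈ box (d + 1) Lc → ∀ k i : ℕ, i < k →
      LocStencil (fun κ' u' => (cE * (Lc : ℝ) ^ (2 * (d + 1))) ^ (k - i) •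
        push₃ (respStep (d := d) (Lc ^ i) (Lc ^ k)) (respStep (d := d) (Lc ^ i) (Lc ^ k)) (respStep (d := d) (Lc ^ i) (Lc ^ k))
          (unitS (sfStep Lc i) (smStep d Lc i) (freshAt Lc (toSite rr) 0 cΛ i)) κ' u') (C * θ ^ (k - i)) δ)
    (hCg : ∃ C θ δ : ℝ, 0 ≤ C ∧ 0 ≤ θ ∧ θ < 1 ∧ 0 < δ ∧ ∀ (rr : Fin (d + 1) → ℕ), rr ∈ box (d + 1) Lc → ∀ k i : ℕ, i < k →
      LocStencil (fun κ' u' => (cE * (Lc : ℝ) ^ (2 * (d + 1))) ^ (k - i) •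
        (push₃ (legChain (respStepBmSeq (toSite rr) Lc) i (k - 1 - i)) (legChain (respStepBmSeq (toSite rr) Lc) i (k - 1 - i))
            (legChain (respStepBmSeq (toSite rr) Lc) i (k - 1 - i)) (unitS (sfStep Lc i) (smStep d Lc i) (freshAt Lc (toSite rr) 0 cΛ i)) κ' u'
          - push₃ (respStep (d := d) (Lc ^ i) (Lc ^ k)) (respStep (d := d) (Lc ^ i) (Lc ^ k)) (respStep (d := d) (Lc ^ i) (Lc ^ k))
            (unitS (sfStep Lc i) (smStep d Lc i) (freshAt Lc (toSite rr) 0 cΛ i)) κ' u')) (C * θ ^ (k - i)) δ) :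
    ∃ C δ : ℝ, 0 < δ ∧ ∀ (rr : Fin (d + 1) → ℕ), rr ∈ box (d + 1) Lc →
      ∀ k : ℕ, LocStencil (unitS (sfStep Lc k) (smStep d Lc k) (bornSecAt Lc (toSite rr) cE 0 cΛ k)) C δ :=
  exists_hBLam_of_letters cE cΛ hX (exists_hU_of_geometric cE cΛ hUg) (exists_hC_of_geometric cE cΛ hCg)

/-- NOT IN PRINT; OUR BOOKKEEPING ((V8) Λ half, END SHAPE at `d = 3`).  **THE Λ-BORN ROW OF THE `d = 3` FAMILY FROM TWO PER-LINEAGE GEOMETRIC LETTERS** — the undressed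
lineages ((V3)-Λ: road S3's row in this currency) and the two-cell contact terms of PART 2, each `≤ C·θ^{k−i}` in `LocStencil` form; `hX` is PART 1's `exists_hX_lam_three`.
This is the statement BORNSEC-PLAN v1's Λ half has to prove, lineage by lineage; nothing of it is claimed here. -/
theorem exists_hBLam_of_geometric_three {Lc : ℕ} [NeZero Lc] (cE cΛ : ℝ)
    (hUg : ∃ C θ δ : ℝ, 0 ≤ C ∧ 0 ≤ θ ∧ θ < 1 ∧ 0 < δ ∧ ∀ (rr : Fin (3 + 1) → ℕ), rr ∈ box (3 + 1) Lc → ∀ k i : ℕ, i < k →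
      LocStencil (fun κ' u' => (cE * (Lc : ℝ) ^ (2 * (3 + 1))) ^ (k - i) •
        push₃ (respStep (d := 3) (Lc ^ i) (Lc ^ k)) (respStep (d := 3) (Lc ^ i) (Lc ^ k)) (respStep (d := 3) (Lc ^ i) (Lc ^ k))
          (unitS (sfStep Lc i) (smStep 3 Lc i) (freshAt Lc (toSite rr) 0 cΛ i)) κ' u') (C * θ ^ (k - i)) δ)
    (hCg : ∃ C θ δ : ℝ, 0 ≤ C ∧ 0 ≤ θ ∧ θ < 1 ∧ 0 < δ ∧ ∀ (rr : Fin (3 + 1) → ℕ), rr ∈ box (3 + 1) Lc → ∀ k i : ℕ, i < k →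
      LocStencil (fun κ' u' => (cE * (Lc : ℝ) ^ (2 * (3 + 1))) ^ (k - i) •
        (push₃ (legChain (respStepBmSeq (toSite rr) Lc) i (k - 1 - i)) (legChain (respStepBmSeq (toSite rr) Lc) i (k - 1 - i))
            (legChain (respStepBmSeq (toSite rr) Lc) i (k - 1 - i)) (unitS (sfStep Lc i) (smStep 3 Lc i) (freshAt Lc (toSite rr) 0 cΛ i)) κ' u'
          - push₃ (respStep (d := 3) (Lc ^ i) (Lc ^ k)) (respStep (d := 3) (Lc ^ i) (Lc ^ k)) (respStep (d := 3) (Lc ^ i) (Lc ^ k))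
            (unitS (sfStep Lc i) (smStep 3 Lc i) (freshAt Lc (toSite rr) 0 cΛ i)) κ' u')) (C * θ ^ (k - i)) δ) :
    ∃ C δ : ℝ, 0 < δ ∧ ∀ (rr : Fin (3 + 1) → ℕ), rr ∈ box (3 + 1) Lc →
      ∀ k : ℕ, LocStencil (unitS (sfStep Lc k) (smStep 3 Lc k) (bornSecAt Lc (toSite rr) cE 0 cΛ k)) C δ :=
  exists_hBLam_of_geometric (d := 3) cE cΛ (exists_hX_lam_three cΛ) hUg hCg

end Letters

end Summit.QuantumFields.BalabanUV.Beta.GAN24.BornLambdaLetters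

end
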